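import Summits.QuantumFields.BalabanUV.Beta.GAN24.W3DriftOfZS
import Summits.QuantumFields.BalabanUV.Beta.GAN24.FirstDiffSymCharge

/-!
# `BalabanUV.Beta.GAN24.W3TowerOfZS` — binder row G-an2-4 / (CONV-C), W-slot road «W3» (gan24-p1-g5 `SKELETON-W3.md` v1.0.2 §8.3; ENDs
# `WSlotT2OfPieces` p213240): **BOTH ENDs AT THE EXACT PIN `cE₂ = +Lc^{2(3+1)}`, `d = 3`, `Lc ≥ 2`, IN THE `ZfreeSym` CURRENCY — «T2Shape» ∧ «T2Drift»
# FOR an2's NORMALISED STAGE-B FAMILY MODULO ROW W3-F2a (the sources' bond-symmetrised cell charges) ONLY: ROW W3-F4d's PIN HALF IS DISCHARGED BY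
# leaf-12's `FirstDiffSymCharge.hZ0_symZ_three`** (G-an2-4 formalisation swarm, leaf prover 08 = the ROW W3-F4a∕F4b lineage, gen 20; journal INTENT
# «W3-F4B-OF-ZS*» l.10226, PART 3; module name PROVISIONAL)

NOT IN PRINT; OUR PROOF ([folklore] composition BY NAME, zero analytic content added).  A SOCKET CERTIFICATE, NOT THE END HEADLINE: the W-rows
`hW₂`∕`hW₂all` of §8.4 and END #3 `WSlotT2Tables` are the row OWNER's; the instantiation `Zfree := ZfreeSym` is leaf-12-g21's THIRD REPAIR of the F4d ⊥
(l.10219∕l.10343; ref2 ruling ASKED — R59-2 records `ZfreeSym` as admissible) and the pin SIGN `+Lc⁸` is ref2's sign of record (R55-3); this module may be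
absorbed ∕ renamed by the owner.  HONEST FRAMING (cell contract, verbatim): «discharging `BetaPertH` makes Bałaban's UV stability UNCONDITIONAL — a real
constructive-QFT result; it is NOT the continuum limit and NOT the Clay problem.»  HONEST DEPENDENCY (verbatim): «continuum YM on T⁴ ⇐ BetaPertH ∧ nine
spine estimates (0/9 proved); BetaPertH ⇐ (D1) ∧ (D4) ∧ CAP+tail; G-an2-4 gates asym, D1 and NE2/3/4.»

PLUGS (all BY NAME, tree theorems): «T2Shape» ∧ «T2Drift» modulo {pin, F2a-sym, F4d-pin-sym} = `W3DriftOfZS.t2ShapeDrift_three_of_F2asym_Z0sym` ∕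
`…_an1_…` (PART 2: END #1 by leaf-12's `T2ShapeThreeOfF2a`, END #2 with F1b leaf-01 ∕ F3b leaf-12 ∕ F4b THIS lineage ∕ F2b `W3ForcingSymZ` ∕ F4d-shape
leaf-07 inside); the pin `|cE₂| ≤ Lc^{2(3+1)}` from the exact pin (`abs_le_of_pinEq`); ROW W3-F4d's pin half in the `ZfreeSym` currency AT THE EXACT PIN =
leaf-12's `FirstDiffSymCharge.hZ0_symZ_three` (its input `hZb0` = ROW W3-F2a at `m = 0`, i.e. `hZ 0`).

WHAT (`d = 3`, `2 ≤ Lc`, EXACT pin `cE₂ = (Lc:ℝ)^(2*(3+1))`; `T♮_j`, `b♮_m` the LITERAL §8.3 texts at the base-root border `vh₂S 3 Lc`):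
* §1 generic block-covariant mixed table (ROWS-MIX `hmix hδ₄ hfm hm` + `hmixt`): **`t2ShapeDrift_three_of_F2asym_pinEq`** —
  «T2Shape» ∧ «T2Drift» ⇐ `∀ m κ κ′ κ₁ κ₂, zmode Lc b♮_m κ κ′ ff + zmode Lc b♮_m κ′ κ ff = 0` (ROW W3-F2a, bond-symmetrised cell charges) ONLY;
  **`t2ShapeDrift_three_of_F2acell_pinEq`** — the same fed by ROW W3-F2a's record cell zero modes `zmode Lc b♮_m κ κ′ ff = 0`.
* §2 an1's mixed table `mixFFAt (toSite r) Lc`, `r ∈ box (3+1) Lc` (ROWS-MIX ∕ `hmixt` free): **`t2ShapeDrift_three_an1_of_F2asym_pinEq`**,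
  **`t2ShapeDrift_three_an1_of_F2acell_pinEq`** — ⇐ ROW W3-F2a ONLY (leaf-20-g18's `zfree_bracket_an1`, kernel-clean in concatenation l.10395, will
  discharge it when its Part D-2 lands: then NO row hypothesis is left at the exact pin).
HONEST: ROW W3-F2a (leaf-20, OPEN as a tree theorem at this head) and the EXACT pin (an2's (P6), undischarged; sign of record ref2 R55-3, an2 unconfirmed)
remain HYPOTHESES; the `ZfreeSym` instantiation awaits the owner's∕ref2's ruling against (R1)∕(R2); asserts NO shape or rate of Bałaban's tables by itself;
«T2Shape»∕«T2SupRate»∕«T2Drift» are thereby tree theorems ONLY RELATIVE TO those hypotheses — as statements about Bałaban's construction they remain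
NOT IN PRINT; discharges NOTHING of (hW₂, hW₂all), the window, the (D1) identification; wall binders: K 2∕2, S 2∕2 are tree theorems at d = 3, Lc ≥ 2, W 0∕2 (this module: reduction only); NOT «W-slot closed» — never under
an undischarged pin; NEVER «G-an2-4 closed», NOT (CONV-C); NOT `BetaPertH`, NOT continuum, NOT Clay.  0 cited facts, 0 `def`, 0 `def … : Prop`, 0 sorry.
Unit `b2b-balaban-gan24-formalise-leaf-08` (G-an2-4 formalisation swarm, leaf prover 08, gen 20), 2026-08-20.
-/

noncomputable section

open Literature.MathematicalPhysics.QuantumFieldTheory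
open Literature.MathematicalPhysics.QuantumFieldTheory.Balaban1983to89
open Literature.MathematicalPhysics.QuantumFieldTheory.Balaban1983to89.Beta
open AffineAveraging (box toSite)
open ExpKernelCalculus (MKer shiftK)
open OneStepResolventKernel (Fib)
open OneStepKernelFamily (KInvStep)
open StepJetData (mfNeg)
open SecondOrderResponse (W2SymOfK LocStencilFM)
open BalabanCompositeJets (LocStencil₂)
open BalabanStepJetsSucc (mmRead)
open BalabanStepW2 (K3OfK Spure M1 M2Of T2Of)
open AveragingMixedJetTables (vh₂S mixFFAt)
open Summit.QuantumFields.BalabanUV.Beta.HessKerDressedUnits (unitK unitS)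
open Summit.QuantumFields.BalabanUV.Beta.SecondOrderUnits (unitM unitS₂ unitM₂)
open Summit.QuantumFields.BalabanUV.Beta.MixedJetTablesPlug (hmix_an1 hmixt_an1)
open Summit.QuantumFields.BalabanUV.Beta.GAN24.CombesThomas (sfStep smStep)
open Summit.QuantumFields.BalabanUV.Beta.GAN24.StencilSlotOfE3 (one_le_of_two_le)
open Summit.QuantumFields.BalabanUV.Beta.GAN24.Push4Iter (BiTab)
open Summit.QuantumFields.BalabanUV.Beta.GAN24.BiStencilZeroMode (zmode)
open Summit.QuantumFields.BalabanUV.Beta.GAN24.T2RecursionAffine (lin4)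
open Summit.QuantumFields.BalabanUV.Beta.GAN24.FirstDiffSymCharge (hZ0_symZ_three)
open Summit.QuantumFields.BalabanUV.Beta.GAN24.W3DriftOfZS (t2ShapeDrift_three_of_F2asym_Z0sym t2ShapeDrift_three_an1_of_F2asym_Z0sym)

namespace Summit.QuantumFields.BalabanUV.Beta.GAN24.W3TowerOfZS

/-- [folklore] The exact pin `cE₂ = +Lc^{2(3+1)}` implies the two-sided pin `|cE₂| ≤ Lc^{2(3+1)}` carried by the ENDs. -/
theorem abs_le_of_pinEq {Lc : ℕ} {cE₂ : ℝ} (hpinEq : cE₂ = (Lc : ℝ) ^ (2 * (3 + 1))) : |cE₂| ≤ (Lc : ℝ) ^ (2 * (3 + 1)) := by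
  rw [hpinEq, abs_of_nonneg (by positivity)]

/-! ## §1 Generic block-covariant mixed table -/

section Three

variable {Lc : ℕ} [NeZero Lc]

/-- **BOTH ENDs AT THE EXACT PIN, generic mixed table, `ZfreeSym` currency, MODULO ROW W3-F2a ONLY** [folklore composition]: at `d = 3`, `Lc ≥ 2`,
`cE₂ = +Lc^{2(3+1)}`, for a mixed table with ROWS-MIX and an2's block covariance `hmixt`: if every source `b♮_m` has vanishing bond-symmetrised cell ff
charge, then «T2Shape» (one constant, one positive rate for every member `T♮_j`) AND «T2Drift» (geometric one-step decay, Cauchy form, entrywise sup-rate)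
hold — `W3DriftOfZS.t2ShapeDrift_three_of_F2asym_Z0sym` with its `hZ0` input DISCHARGED by leaf-12's `FirstDiffSymCharge.hZ0_symZ_three` (fed by `hZ 0`). -/
theorem t2ShapeDrift_three_of_F2asym_pinEq (hLc : 2 ≤ Lc) (cE cVH cΛ cE₂ cB : ℝ) (Tc : Fin 4 → Fin 4 → Fin 4 → Fin 4 → ℝ)
    {mixFF : BiTab 3} {CM₂ δ₄ : ℝ} (hmix : LocStencilFM Lc mixFF CM₂ δ₄) (hδ₄ : 0 < δ₄)
    (hfm : ∀ κ u ρ w x z (α μ' : Fin (3 + 1)), mixFF κ u ρ w x z (Sum.inl α) (Sum.inr μ') = 0)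
    (hm : ∀ κ u ρ w x z (μ' : Fin (3 + 1)) (b : Fib 3), mixFF κ u ρ w x z (Sum.inr μ') b = 0)
    (hmixt : ∀ (κ : Fin (3 + 1)) (u : Fin (3 + 1) → ℤ) (ρ : Fin (3 + 1)) (w t : Fin (3 + 1) → ℤ),
      mixFF κ (u + (Lc : ℤ) • t) ρ (w + t) = shiftK (-((Lc : ℤ) • t)) (mixFF κ u ρ w))
    (hpinEq : cE₂ = (Lc : ℝ) ^ (2 * (3 + 1)))
    (hZ : ∀ m : ℕ, (∀ κ κ' κ₁ κ₂, zmode Lc (fun κ u κ' u' =>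
        (cE₂ * (Lc : ℝ) ^ (2 * (3 + 1))) •
            mmRead Lc (K3OfK (unitK (sfStep Lc m) (smStep 3 Lc m) (KInvStep (d := 3) Lc m)) Lc
              (unitS (sfStep Lc m) (smStep 3 Lc m) (Spure 3 Lc cE cVH cΛ m)) (unitM (sfStep Lc m) (smStep 3 Lc m) (M1 3 Lc cΛ m))
              (W2SymOfK (unitK (sfStep Lc m) (smStep 3 Lc m) (KInvStep (d := 3) Lc m)) Lc
                (unitS (sfStep Lc m) (smStep 3 Lc m) (Spure 3 Lc cE cVH cΛ m)) (unitM (sfStep Lc m) (smStep 3 Lc m) (M1 3 Lc cΛ m)) 0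
                (unitM₂ (sfStep Lc m) (smStep 3 Lc m) (M2Of 3 Lc mixFF m))) κ u κ' u')
          + cB • mfNeg ((vh₂S 3 Lc) κ u κ' u')) κ κ' (Sum.inl κ₁) (Sum.inl κ₂) + zmode Lc (fun κ u κ' u' =>
        (cE₂ * (Lc : ℝ) ^ (2 * (3 + 1))) •
            mmRead Lc (K3OfK (unitK (sfStep Lc m) (smStep 3 Lc m) (KInvStep (d := 3) Lc m)) Lc
              (unitS (sfStep Lc m) (smStep 3 Lc m) (Spure 3 Lc cE cVH cΛ m)) (unitM (sfStep Lc m) (smStep 3 Lc m) (M1 3 Lc cΛ m))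
              (W2SymOfK (unitK (sfStep Lc m) (smStep 3 Lc m) (KInvStep (d := 3) Lc m)) Lc
                (unitS (sfStep Lc m) (smStep 3 Lc m) (Spure 3 Lc cE cVH cΛ m)) (unitM (sfStep Lc m) (smStep 3 Lc m) (M1 3 Lc cΛ m)) 0
                (unitM₂ (sfStep Lc m) (smStep 3 Lc m) (M2Of 3 Lc mixFF m))) κ u κ' u')
          + cB • mfNeg ((vh₂S 3 Lc) κ u κ' u')) κ' κ (Sum.inl κ₁) (Sum.inl κ₂) = 0)) :
    (∃ C₂ δ₂ : ℝ, 0 < δ₂ ∧ ∀ j, LocStencil₂ (unitS₂ (sfStep Lc j) (smStep 3 Lc j) (T2Of 3 Lc cE cVH cΛ cE₂ cB Tc (vh₂S 3 Lc) mixFF j)) C₂ δ₂) ∧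
    (∃ c ϑ δT : ℝ, 0 ≤ c ∧ 0 < ϑ ∧ ϑ < 1 ∧ 0 < δT ∧
      (∀ n, LocStencil₂ (fun κ u κ' u' => unitS₂ (sfStep Lc (n + 1)) (smStep 3 Lc (n + 1)) (T2Of 3 Lc cE cVH cΛ cE₂ cB Tc (vh₂S 3 Lc) mixFF (n + 1)) κ u κ' u' - unitS₂ (sfStep Lc n) (smStep 3 Lc n) (T2Of 3 Lc cE cVH cΛ cE₂ cB Tc (vh₂S 3 Lc) mixFF n) κ u κ' u') (c * ϑ ^ n) δT) ∧
      (∀ k j, LocStencil₂ (fun κ u κ' u' => unitS₂ (sfStep Lc (k + j)) (smStep 3 Lc (k + j)) (T2Of 3 Lc cE cVH cΛ cE₂ cB Tc (vh₂S 3 Lc) mixFF (k + j)) κ u κ' u' - unitS₂ (sfStep Lc k) (smStep 3 Lc k) (T2Of 3 Lc cE cVH cΛ cE₂ cB Tc (vh₂S 3 Lc) mixFF k) κ u κ' u') (c * (1 - ϑ)⁻¹ * ϑ ^ k) δT) ∧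
      (∀ n κ u κ' u' x z a b, |unitS₂ (sfStep Lc (n + 1)) (smStep 3 Lc (n + 1)) (T2Of 3 Lc cE cVH cΛ cE₂ cB Tc (vh₂S 3 Lc) mixFF (n + 1)) κ u κ' u' x z a b - unitS₂ (sfStep Lc n) (smStep 3 Lc n) (T2Of 3 Lc cE cVH cΛ cE₂ cB Tc (vh₂S 3 Lc) mixFF n) κ u κ' u' x z a b| ≤ c * ϑ ^ n)) :=
  t2ShapeDrift_three_of_F2asym_Z0sym hLc cE cVH cΛ cE₂ cB Tc hmix hδ₄ hfm hm hmixt (abs_le_of_pinEq hpinEq) hZ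
    (hZ0_symZ_three (one_le_of_two_le hLc) cE cVH cΛ cE₂ cB Tc ⟨CM₂, δ₄, hδ₄, hmix⟩ hmixt hpinEq (hZ 0)).2

/-- **BOTH ENDs AT THE EXACT PIN, generic mixed table, FED BY ROW W3-F2a's RECORD CELL ZERO MODES** (`zmode Lc b♮_m κ κ′ ff = 0`, the second conjunct of the
`Zfree` of record — leaf-20's `zfree_bracket … |>.2` currency) [folklore: the bond-symmetrised charge is `0 + 0`]. -/
theorem t2ShapeDrift_three_of_F2acell_pinEq (hLc : 2 ≤ Lc) (cE cVH cΛ cE₂ cB : ℝ) (Tc : Fin 4 → Fin 4 → Fin 4 → Fin 4 → ℝ)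
    {mixFF : BiTab 3} {CM₂ δ₄ : ℝ} (hmix : LocStencilFM Lc mixFF CM₂ δ₄) (hδ₄ : 0 < δ₄)
    (hfm : ∀ κ u ρ w x z (α μ' : Fin (3 + 1)), mixFF κ u ρ w x z (Sum.inl α) (Sum.inr μ') = 0)
    (hm : ∀ κ u ρ w x z (μ' : Fin (3 + 1)) (b : Fib 3), mixFF κ u ρ w x z (Sum.inr μ') b = 0)
    (hmixt : ∀ (κ : Fin (3 + 1)) (u : Fin (3 + 1) → ℤ) (ρ : Fin (3 + 1)) (w t : Fin (3 + 1) → ℤ),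
      mixFF κ (u + (Lc : ℤ) • t) ρ (w + t) = shiftK (-((Lc : ℤ) • t)) (mixFF κ u ρ w))
    (hpinEq : cE₂ = (Lc : ℝ) ^ (2 * (3 + 1)))
    (hZ : ∀ m : ℕ, (∀ κ κ' κ₁ κ₂, zmode Lc (fun κ u κ' u' =>
        (cE₂ * (Lc : ℝ) ^ (2 * (3 + 1))) •
            mmRead Lc (K3OfK (unitK (sfStep Lc m) (smStep 3 Lc m) (KInvStep (d := 3) Lc m)) Lc
              (unitS (sfStep Lc m) (smStep 3 Lc m) (Spure 3 Lc cE cVH cΛ m)) (unitM (sfStep Lc m) (smStep 3 Lc m) (M1 3 Lc cΛ m))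
              (W2SymOfK (unitK (sfStep Lc m) (smStep 3 Lc m) (KInvStep (d := 3) Lc m)) Lc
                (unitS (sfStep Lc m) (smStep 3 Lc m) (Spure 3 Lc cE cVH cΛ m)) (unitM (sfStep Lc m) (smStep 3 Lc m) (M1 3 Lc cΛ m)) 0
                (unitM₂ (sfStep Lc m) (smStep 3 Lc m) (M2Of 3 Lc mixFF m))) κ u κ' u')
          + cB • mfNeg ((vh₂S 3 Lc) κ u κ' u')) κ κ' (Sum.inl κ₁) (Sum.inl κ₂) = 0)) :
    (∃ C₂ δ₂ : ℝ, 0 < δ₂ ∧ ∀ j, LocStencil₂ (unitS₂ (sfStep Lc j) (smStep 3 Lc j) (T2Of 3 Lc cE cVH cΛ cE₂ cB Tc (vh₂S 3 Lc) mixFF j)) C₂ δ₂) ∧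
    (∃ c ϑ δT : ℝ, 0 ≤ c ∧ 0 < ϑ ∧ ϑ < 1 ∧ 0 < δT ∧
      (∀ n, LocStencil₂ (fun κ u κ' u' => unitS₂ (sfStep Lc (n + 1)) (smStep 3 Lc (n + 1)) (T2Of 3 Lc cE cVH cΛ cE₂ cB Tc (vh₂S 3 Lc) mixFF (n + 1)) κ u κ' u' - unitS₂ (sfStep Lc n) (smStep 3 Lc n) (T2Of 3 Lc cE cVH cΛ cE₂ cB Tc (vh₂S 3 Lc) mixFF n) κ u κ' u') (c * ϑ ^ n) δT) ∧
      (∀ k j, LocStencil₂ (fun κ u κ' u' => unitS₂ (sfStep Lc (k + j)) (smStep 3 Lc (k + j)) (T2Of 3 Lc cE cVH cΛ cE₂ cB Tc (vh₂S 3 Lc) mixFF (k + j)) κ u κ' u' - unitS₂ (sfStep Lc k) (smStep 3 Lc k) (T2Of 3 Lc cE cVH cΛ cE₂ cB Tc (vh₂S 3 Lc) mixFF k) κ u κ' u') (c * (1 - ϑ)⁻¹ * ϑ ^ k) δT) ∧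
      (∀ n κ u κ' u' x z a b, |unitS₂ (sfStep Lc (n + 1)) (smStep 3 Lc (n + 1)) (T2Of 3 Lc cE cVH cΛ cE₂ cB Tc (vh₂S 3 Lc) mixFF (n + 1)) κ u κ' u' x z a b - unitS₂ (sfStep Lc n) (smStep 3 Lc n) (T2Of 3 Lc cE cVH cΛ cE₂ cB Tc (vh₂S 3 Lc) mixFF n) κ u κ' u' x z a b| ≤ c * ϑ ^ n)) :=
  t2ShapeDrift_three_of_F2asym_pinEq hLc cE cVH cΛ cE₂ cB Tc hmix hδ₄ hfm hm hmixt hpinEq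
    (fun m κ κ' κ₁ κ₂ => by rw [hZ m, hZ m, add_zero])

end Three

/-! ## §2 an1's mixed table at a box root -/

section An1

variable {Lc : ℕ} [NeZero Lc] {r : Fin (3 + 1) → ℕ}

/-- **BOTH ENDs AT THE EXACT PIN FOR an1's MIXED TABLE `mixFFAt (toSite r) Lc` (`r ∈ box (3+1) Lc`), `ZfreeSym` currency, MODULO ROW W3-F2a ONLY**
[folklore composition: `W3DriftOfZS.t2ShapeDrift_three_an1_of_F2asym_Z0sym` + `FirstDiffSymCharge.hZ0_symZ_three` at `hmix_an1`∕`hmixt_an1`]. -/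
theorem t2ShapeDrift_three_an1_of_F2asym_pinEq (hLc : 2 ≤ Lc) (hr : r ∈ box (3 + 1) Lc) (cE cVH cΛ cE₂ cB : ℝ)
    (Tc : Fin 4 → Fin 4 → Fin 4 → Fin 4 → ℝ)
    (hpinEq : cE₂ = (Lc : ℝ) ^ (2 * (3 + 1)))
    (hZ : ∀ m : ℕ, (∀ κ κ' κ₁ κ₂, zmode Lc (fun κ u κ' u' =>
        (cE₂ * (Lc : ℝ) ^ (2 * (3 + 1))) •
            mmRead Lc (K3OfK (unitK (sfStep Lc m) (smStep 3 Lc m) (KInvStep (d := 3) Lc m)) Lc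
              (unitS (sfStep Lc m) (smStep 3 Lc m) (Spure 3 Lc cE cVH cΛ m)) (unitM (sfStep Lc m) (smStep 3 Lc m) (M1 3 Lc cΛ m))
              (W2SymOfK (unitK (sfStep Lc m) (smStep 3 Lc m) (KInvStep (d := 3) Lc m)) Lc
                (unitS (sfStep Lc m) (smStep 3 Lc m) (Spure 3 Lc cE cVH cΛ m)) (unitM (sfStep Lc m) (smStep 3 Lc m) (M1 3 Lc cΛ m)) 0
                (unitM₂ (sfStep Lc m) (smStep 3 Lc m) (M2Of 3 Lc (mixFFAt (toSite r) Lc) m))) κ u κ' u')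
          + cB • mfNeg ((vh₂S 3 Lc) κ u κ' u')) κ κ' (Sum.inl κ₁) (Sum.inl κ₂) + zmode Lc (fun κ u κ' u' =>
        (cE₂ * (Lc : ℝ) ^ (2 * (3 + 1))) •
            mmRead Lc (K3OfK (unitK (sfStep Lc m) (smStep 3 Lc m) (KInvStep (d := 3) Lc m)) Lc
              (unitS (sfStep Lc m) (smStep 3 Lc m) (Spure 3 Lc cE cVH cΛ m)) (unitM (sfStep Lc m) (smStep 3 Lc m) (M1 3 Lc cΛ m))
              (W2SymOfK (unitK (sfStep Lc m) (smStep 3 Lc m) (KInvStep (d := 3) Lc m)) Lc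
                (unitS (sfStep Lc m) (smStep 3 Lc m) (Spure 3 Lc cE cVH cΛ m)) (unitM (sfStep Lc m) (smStep 3 Lc m) (M1 3 Lc cΛ m)) 0
                (unitM₂ (sfStep Lc m) (smStep 3 Lc m) (M2Of 3 Lc (mixFFAt (toSite r) Lc) m))) κ u κ' u')
          + cB • mfNeg ((vh₂S 3 Lc) κ u κ' u')) κ' κ (Sum.inl κ₁) (Sum.inl κ₂) = 0)) :
    (∃ C₂ δ₂ : ℝ, 0 < δ₂ ∧ ∀ j, LocStencil₂ (unitS₂ (sfStep Lc j) (smStep 3 Lc j) (T2Of 3 Lc cE cVH cΛ cE₂ cB Tc (vh₂S 3 Lc) (mixFFAt (toSite r) Lc) j)) C₂ δ₂) ∧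
    (∃ c ϑ δT : ℝ, 0 ≤ c ∧ 0 < ϑ ∧ ϑ < 1 ∧ 0 < δT ∧
      (∀ n, LocStencil₂ (fun κ u κ' u' => unitS₂ (sfStep Lc (n + 1)) (smStep 3 Lc (n + 1)) (T2Of 3 Lc cE cVH cΛ cE₂ cB Tc (vh₂S 3 Lc) (mixFFAt (toSite r) Lc) (n + 1)) κ u κ' u' - unitS₂ (sfStep Lc n) (smStep 3 Lc n) (T2Of 3 Lc cE cVH cΛ cE₂ cB Tc (vh₂S 3 Lc) (mixFFAt (toSite r) Lc) n) κ u κ' u') (c * ϑ ^ n) δT) ∧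
      (∀ k j, LocStencil₂ (fun κ u κ' u' => unitS₂ (sfStep Lc (k + j)) (smStep 3 Lc (k + j)) (T2Of 3 Lc cE cVH cΛ cE₂ cB Tc (vh₂S 3 Lc) (mixFFAt (toSite r) Lc) (k + j)) κ u κ' u' - unitS₂ (sfStep Lc k) (smStep 3 Lc k) (T2Of 3 Lc cE cVH cΛ cE₂ cB Tc (vh₂S 3 Lc) (mixFFAt (toSite r) Lc) k) κ u κ' u') (c * (1 - ϑ)⁻¹ * ϑ ^ k) δT) ∧
      (∀ n κ u κ' u' x z a b, |unitS₂ (sfStep Lc (n + 1)) (smStep 3 Lc (n + 1)) (T2Of 3 Lc cE cVH cΛ cE₂ cB Tc (vh₂S 3 Lc) (mixFFAt (toSite r) Lc) (n + 1)) κ u κ' u' x z a b - unitS₂ (sfStep Lc n) (smStep 3 Lc n) (T2Of 3 Lc cE cVH cΛ cE₂ cB Tc (vh₂S 3 Lc) (mixFFAt (toSite r) Lc) n) κ u κ' u' x z a b| ≤ c * ϑ ^ n)) :=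
  t2ShapeDrift_three_an1_of_F2asym_Z0sym hLc hr cE cVH cΛ cE₂ cB Tc (abs_le_of_pinEq hpinEq) hZ
    (hZ0_symZ_three (one_le_of_two_le hLc) cE cVH cΛ cE₂ cB Tc (hmix_an1 (d := 3) (Lc := Lc) (one_le_of_two_le hLc) hr)
      (hmixt_an1 (toSite r)) hpinEq (hZ 0)).2

/-- **BOTH ENDs AT THE EXACT PIN FOR an1's MIXED TABLE, FED BY ROW W3-F2a's RECORD CELL ZERO MODES** — the partial application
`leaf-20's zfree_bracket_an1 … · |>.2` is exactly `hZ` here; when its Part D-2 lands NO row hypothesis is left at the exact pin. -/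
theorem t2ShapeDrift_three_an1_of_F2acell_pinEq (hLc : 2 ≤ Lc) (hr : r ∈ box (3 + 1) Lc) (cE cVH cΛ cE₂ cB : ℝ)
    (Tc : Fin 4 → Fin 4 → Fin 4 → Fin 4 → ℝ)
    (hpinEq : cE₂ = (Lc : ℝ) ^ (2 * (3 + 1)))
    (hZ : ∀ m : ℕ, (∀ κ κ' κ₁ κ₂, zmode Lc (fun κ u κ' u' =>
        (cE₂ * (Lc : ℝ) ^ (2 * (3 + 1))) •
            mmRead Lc (K3OfK (unitK (sfStep Lc m) (smStep 3 Lc m) (KInvStep (d := 3) Lc m)) Lc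
              (unitS (sfStep Lc m) (smStep 3 Lc m) (Spure 3 Lc cE cVH cΛ m)) (unitM (sfStep Lc m) (smStep 3 Lc m) (M1 3 Lc cΛ m))
              (W2SymOfK (unitK (sfStep Lc m) (smStep 3 Lc m) (KInvStep (d := 3) Lc m)) Lc
                (unitS (sfStep Lc m) (smStep 3 Lc m) (Spure 3 Lc cE cVH cΛ m)) (unitM (sfStep Lc m) (smStep 3 Lc m) (M1 3 Lc cΛ m)) 0
                (unitM₂ (sfStep Lc m) (smStep 3 Lc m) (M2Of 3 Lc (mixFFAt (toSite r) Lc) m))) κ u κ' u')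
          + cB • mfNeg ((vh₂S 3 Lc) κ u κ' u')) κ κ' (Sum.inl κ₁) (Sum.inl κ₂) = 0)) :
    (∃ C₂ δ₂ : ℝ, 0 < δ₂ ∧ ∀ j, LocStencil₂ (unitS₂ (sfStep Lc j) (smStep 3 Lc j) (T2Of 3 Lc cE cVH cΛ cE₂ cB Tc (vh₂S 3 Lc) (mixFFAt (toSite r) Lc) j)) C₂ δ₂) ∧
    (∃ c ϑ δT : ℝ, 0 ≤ c ∧ 0 < ϑ ∧ ϑ < 1 ∧ 0 < δT ∧
      (∀ n, LocStencil₂ (fun κ u κ' u' => unitS₂ (sfStep Lc (n + 1)) (smStep 3 Lc (n + 1)) (T2Of 3 Lc cE cVH cΛ cE₂ cB Tc (vh₂S 3 Lc) (mixFFAt (toSite r) Lc) (n + 1)) κ u κ' u' - unitS₂ (sfStep Lc n) (smStep 3 Lc n) (T2Of 3 Lc cE cVH cΛ cE₂ cB Tc (vh₂S 3 Lc) (mixFFAt (toSite r) Lc) n) κ u κ' u') (c * ϑ ^ n) δT) ∧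
      (∀ k j, LocStencil₂ (fun κ u κ' u' => unitS₂ (sfStep Lc (k + j)) (smStep 3 Lc (k + j)) (T2Of 3 Lc cE cVH cΛ cE₂ cB Tc (vh₂S 3 Lc) (mixFFAt (toSite r) Lc) (k + j)) κ u κ' u' - unitS₂ (sfStep Lc k) (smStep 3 Lc k) (T2Of 3 Lc cE cVH cΛ cE₂ cB Tc (vh₂S 3 Lc) (mixFFAt (toSite r) Lc) k) κ u κ' u') (c * (1 - ϑ)⁻¹ * ϑ ^ k) δT) ∧
      (∀ n κ u κ' u' x z a b, |unitS₂ (sfStep Lc (n + 1)) (smStep 3 Lc (n + 1)) (T2Of 3 Lc cE cVH cΛ cE₂ cB Tc (vh₂S 3 Lc) (mixFFAt (toSite r) Lc) (n + 1)) κ u κ' u' x z a b - unitS₂ (sfStep Lc n) (smStep 3 Lc n) (T2Of 3 Lc cE cVH cΛ cE₂ cB Tc (vh₂S 3 Lc) (mixFFAt (toSite r) Lc) n) κ u κ' u' x z a b| ≤ c * ϑ ^ n)) :=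
  t2ShapeDrift_three_an1_of_F2asym_pinEq hLc hr cE cVH cΛ cE₂ cB Tc hpinEq (fun m κ κ' κ₁ κ₂ => by rw [hZ m, hZ m, add_zero])

end An1

end Summit.QuantumFields.BalabanUV.Beta.GAN24.W3TowerOfZS

end
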